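import Literature.AlgebraicGeometry.Resolution.ArithmeticalThreefoldsLocalDescentInertiaHensel
import Literature.AlgebraicGeometry.Resolution.KrullRamificationHenselSubfields
import HarnessLib

/-!
# The stable-model input of the inertia layer is NECESSARY: `(LU Mˢ)` gives a `Gˢ`-stable local uniformization of `Mⁱ` containing `η`

Topic: `Literature/AlgebraicGeometry/Resolution`. PROOF side of `CossartPiltant2019ReductionP`
(`ArithmeticalThreefoldsLocal.lean`), input (C4), inertia layer of [CoP1] Prop. 9.3. The input
`hStabIη` of `cossartPiltant2019ReductionP_of_cjs_of_stableInertiaHensel`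
(`ArithmeticalThreefoldsLocalDescentInertiaHensel.lean`) — "from `(LU Mⁱ)`, a local
uniformization `S[t]` of `Mⁱ` whose local ring is `Gˢ`-stable and contains the henselian
generator `η`" — implies the inertia-layer descent `(LU Mⁱ) ⇒ (LU Mˢ)`
(`exists_model_decompositionField_of_stableModel`). This file proves the CONVERSE direction:
from `(LU Mˢ)` and cofinality at `Mˢ` ([CoP1] Cor. 4.6), the étale climb `S[r] ↦ S[r, η]`
([CoP1] Cor. 6.3, tree `ArithmeticalThreefoldsLocalEtaleClimb.lean`) produces exactly such a
local uniformization of `Mⁱ`: its local ring is regular (étale over regular), hence NORMAL, so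
it contains every `Gˢ`-conjugate `τη` of `η` (a root of the same monic `F` over `(S[r])_𝔪`),
and is therefore `Gˢ`-stable — it is "the unique normal local model of `W ∩ Kⁱ` lying above"
the model `(S[r])_𝔪` of `Kˢ` (HAL p. 28; CP 2019 Def. 4.12). Hence `hStabIη` is EQUIVALENT,
modulo cofinality, to the inertia-layer descent: the reformulation isolates the unprinted
principle (equivariant local uniformization of the inertia field) without strengthening it.

* `isRegularLocalRing_locAtCentre_insert_of_henselRoot` — PROVED: the étale climb with the
  generating set `t ∪ {η}` made explicit (`exists_model_adjoin_of_henselRoot` hides it);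
* `eval_map_decompositionGroup_henselRoot` — PROVED: `τ ∈ Gˢ` maps `η` to a root of `F`;
* `mem_of_isIntegral_of_mul_mem_subring` — PROVED: normality of a subring realised in a field;
* `exists_stableInertiaHensel_of_model_decompositionField` — PROVED: `(LU Mˢ)` + cofinality at
  `Mˢ` ⟹ the data of `hStabIη`.

Everything is PROVED; no named facts, definitions, instances or notation are introduced.

## Sources

* V. Cossart, O. Piltant, J. Algebra 320 (2008) 1051–1082: proof of Prop. 9.3 (HAL
  hal-00139124, pp. 27–28), Cor. 4.6, Cor. 6.3. [CossartPiltant2008]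
* V. Cossart, O. Piltant, J. Algebra 529 (2019) 268–535: Def. 4.12, Prop. 4.13.
  [CossartPiltant2019]
-/

noncomputable section

open CategoryTheory AlgebraicGeometry TopologicalSpace IsLocalRing _root_.Polynomial
  _root_.IntermediateField

namespace Literature.AlgebraicGeometry.Resolution

universe u

/-! ## The étale climb with explicit generating set -/

section Climb

variable {S Ω : Type u} [CommRing S] [Field Ω] [Algebra S Ω] (OΩ : ValuationSubring Ω)

/-- **[CoP1] Cor. 6.3 with the generating set made explicit**: for a model `S[t] ⊆ O_Ω` regular
at the centre and a henselian element `η ∈ O_Ω` (root of a monic `F` with `v(F′(η)) = 0` whose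
coefficients are fractions `a/s`, `a, s ∈ S[t]`, `v(s) = 0`), the model `S[t, η] ⊆ O_Ω` is
regular at the centre ("`R′` is local-étale over `R` … Then `R′` is regular, since `R` is").
[cite: CossartPiltant2008, Cor. 6.3 (HAL p. 18)] -/
theorem isRegularLocalRing_locAtCentre_insert_of_henselRoot [DecidableEq Ω]
    (t : Finset Ω) (hTO : (Algebra.adjoin S (t : Set Ω)).toSubring ≤ OΩ.toSubring)
    (hreg : IsRegularLocalRing (Localization.AtPrime
      (Ideal.comap (Subring.inclusion hTO) (maximalIdeal OΩ))))
    (η : Ω) (hη : η ∈ OΩ) (F : Polynomial Ω) (hFmon : F.Monic) (hFη : F.eval η = 0)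
    (hF' : OΩ.valuation ((derivative F).eval η) = 1)
    (hcoef : ∀ i, ∃ a s : Ω, a ∈ Algebra.adjoin S (t : Set Ω) ∧ s ∈ Algebra.adjoin S (t : Set Ω) ∧
      OΩ.valuation s = 1 ∧ F.coeff i * s = a) :
    (Algebra.adjoin S ((insert η t : Finset Ω) : Set Ω)).toSubring ≤ OΩ.toSubring ∧
      IsRegularLocalRing (locAtCentre (Algebra.adjoin S ((insert η t : Finset Ω) : Set Ω)).toSubring OΩ) := by
  let T : Subalgebra S Ω := Algebra.adjoin S (t : Set Ω)
  let P : Ideal T := Ideal.comap (Subring.inclusion hTO) (maximalIdeal OΩ)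
  haveI : P.IsPrime := Ideal.IsPrime.comap _
  have hP : ∀ x : T, x ∈ P ↔ OΩ.valuation (x : Ω) < 1 := fun x => by
    change Subring.inclusion hTO x ∈ maximalIdeal OΩ ↔ _
    rw [ValuationSubring.valuation_lt_one_iff]
    rfl
  have hTO' : ∀ x : T, (x : Ω) ∈ OΩ := fun x => hTO x.2
  let Sₚ : Type u := Localization.AtPrime P
  haveI : IsRegularLocalRing Sₚ := hreg
  have hunits : ∀ y : P.primeCompl, IsUnit (algebraMap T Ω y) := fun y => by
    rw [isUnit_iff_ne_zero]
    intro h0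
    apply y.2
    have : (y : T) = 0 := Subtype.ext h0
    rw [this]
    exact P.zero_mem
  letI : Algebra Sₚ Ω := (IsLocalization.lift (M := P.primeCompl) hunits).toAlgebra
  haveI : IsScalarTower T Sₚ Ω :=
    IsScalarTower.of_algebraMap_eq fun a => (IsLocalization.lift_eq hunits a).symm
  haveI : IsScalarTower S Sₚ Ω := IsScalarTower.of_algebraMap_eq fun s => by
    rw [IsScalarTower.algebraMap_apply S T Sₚ, ← IsScalarTower.algebraMap_apply T Sₚ Ω,
      ← IsScalarTower.algebraMap_apply S T Ω]
  obtain ⟨hAO, hregA⟩ := exists_adjoin_union_isRegularLocalRing_of_henselRoot OΩ T hTO' P hP Sₚ η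
    hη F hFmon hFη hF' hcoef
  have hset : Algebra.adjoin S ((insert η t : Finset Ω) : Set Ω) =
      Algebra.adjoin S ((T : Set Ω) ∪ ({η} : Set Ω)) := by
    rw [Finset.coe_insert]
    apply le_antisymm
    · apply Algebra.adjoin_le
      rintro z (hz | hz)
      · exact Algebra.subset_adjoin (Set.mem_union_right _ hz)
      · exact Algebra.subset_adjoin (Set.mem_union_left _ (Algebra.subset_adjoin hz))
    · apply Algebra.adjoin_le
      rintro z (hz | hz)
      · exact Algebra.adjoin_mono (Set.subset_insert _ _) hz
      · exact Algebra.subset_adjoin (Set.mem_insert_iff.mpr (Or.inl hz))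
  have hTOnew : (Algebra.adjoin S ((insert η t : Finset Ω) : Set Ω)).toSubring ≤ OΩ.toSubring := by
    rw [hset]
    exact hAO
  refine ⟨hTOnew, ?_⟩
  have hsub : (Algebra.adjoin S ((insert η t : Finset Ω) : Set Ω)).toSubring =
      (Algebra.adjoin S ((T : Set Ω) ∪ ({η} : Set Ω))).toSubring := by rw [hset]
  rw [hsub]
  exact (isRegularLocalRing_locAtCentre_iff hAO).mpr hregA

end Climb

/-! ## Conjugates of the henselian generator; normality of a subring realised in a field -/

section Tools

variable {Ω : Type u} [Field Ω]

/-- **Normality, realised in a field**: if the subring `T ⊆ Ω` is integrally closed (in its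
fraction field) and `z ∈ Ω` is integral over `T` with `u z ∈ T` for some `0 ≠ u ∈ T`, then
`z ∈ T` (the `Subring` form of `mem_of_isIntegral_of_mul_mem`, `DChartRoof.lean`).
[cite: CossartPiltant2019, Def. 4.12 (normal local models)] -/
theorem mem_of_isIntegral_of_mul_mem_subring (T : Subring Ω) [IsIntegrallyClosed T] {z : Ω}
    (hz : IsIntegral T z) {u : Ω} (huT : u ∈ T) (hu0 : u ≠ 0) (huz : u * z ∈ T) : z ∈ T := by
  haveI : IsDomain T := Function.Injective.isDomain (algebraMap T Ω) Subtype.val_injective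
  let Kf := FractionRing T
  have hinj : Function.Injective (algebraMap T Ω) := Subtype.val_injective
  let φ : Kf →+* Ω := IsFractionRing.lift hinj
  have hφalg : ∀ t : T, φ (algebraMap T Kf t) = (t : Ω) := fun t => IsFractionRing.lift_algebraMap hinj t
  have hu' : (⟨u, huT⟩ : T) ∈ nonZeroDivisors T :=
    mem_nonZeroDivisors_of_ne_zero fun h0 => hu0 (congrArg Subtype.val h0)
  set xK : Kf := IsLocalization.mk' Kf (⟨u * z, huz⟩ : T) ⟨⟨u, huT⟩, hu'⟩ with hxK
  have hφx : φ xK = z := by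
    have h1 : xK * algebraMap T Kf ⟨u, huT⟩ = algebraMap T Kf ⟨u * z, huz⟩ :=
      IsLocalization.mk'_spec Kf _ _
    have h2 := congrArg φ h1
    rw [map_mul, hφalg, hφalg] at h2
    have h3 : φ xK * u = z * u := by rw [h2]; exact mul_comm u z
    exact mul_right_cancel₀ hu0 h3
  have hxint : IsIntegral T xK := by
    obtain ⟨p, hpm, hpz⟩ := hz
    refine ⟨p, hpm, ?_⟩
    apply φ.injective
    rw [Polynomial.hom_eval₂, map_zero]
    have hcomp : φ.comp (algebraMap T Kf) = algebraMap T Ω := RingHom.ext fun t => hφalg t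
    rw [hcomp, hφx]
    exact hpz
  obtain ⟨y, hy⟩ := (IsIntegrallyClosed.isIntegral_iff (R := T) (K := Kf)).mp hxint
  have : (y : Ω) = z := by rw [← hφalg, hy, hφx]
  rw [← this]
  exact y.2

variable (V : ValuationSubring Ω) {M : Subfield Ω} (N : IntermediateField M Ω)

/-- `τ ∈ Gal(N|M)` fixing the coefficients of `F` (which lie in the fixed field of `Gˢ ∋ τ`) maps
a root `η ∈ N` of `F` to a root of `F`. [cite: ZariskiSamuel1960, Ch. VI §12] -/
theorem eval_map_decompositionGroup_henselRoot {η : Ω} (hηN : η ∈ N) (F : Polynomial Ω)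
    (hFcoeff : ∀ k, F.coeff k ∈ (lift (fixedField (decompositionGroupIn V N))).toSubfield)
    (hFη : F.eval η = 0) {τ : N ≃ₐ[M] N} (hτs : τ ∈ decompositionGroupIn V N) :
    F.eval ((τ ⟨η, hηN⟩ : N) : Ω) = 0 := by
  classical
  let ι : N →+* Ω := algebraMap N Ω
  have hcoN : ∀ k, F.coeff k ∈ N := fun k => lift_le _ (show F.coeff k ∈ lift _ from hFcoeff k)
  have hl : F ∈ Polynomial.lifts ι := by
    rw [Polynomial.lifts_iff_coeff_lifts]
    exact fun k => ⟨⟨F.coeff k, hcoN k⟩, rfl⟩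
  obtain ⟨P, hP⟩ := (Polynomial.mem_lifts _).mp hl
  have hPcoeff : ∀ k, (P.coeff k : Ω) = F.coeff k := fun k => by
    rw [← hP, Polynomial.coeff_map]; rfl
  let G := ↥(decompositionGroupIn V N)
  let g : G := ⟨τ, hτs⟩
  have hsmul : ∀ (x : N), g • x = τ x := fun _ => rfl
  have hPg : g • P = P := Polynomial.ext fun k => by
    rw [Polynomial.coeff_smul, hsmul]
    have h2 : ((P.coeff k : N) : Ω) ∈ lift (fixedField (decompositionGroupIn V N)) := by
      rw [hPcoeff]; exact hFcoeff k
    exact (mem_fixedField_iff _ _).mp ((IntermediateField.mem_lift (P.coeff k)).mp h2) τ hτs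
  have hPη : P.eval ⟨η, hηN⟩ = 0 := by
    apply ι.injective
    rw [← Polynomial.eval₂_hom, ← Polynomial.eval_map, hP, map_zero]
    exact hFη
  have h1 : P.eval (τ ⟨η, hηN⟩) = 0 := by
    rw [← hsmul, ← hPg, Polynomial.smul_eval_smul, hPη, smul_zero]
  have h2 := congrArg ι h1
  rw [← Polynomial.eval₂_hom, ← Polynomial.eval_map, hP, map_zero] at h2
  exact h2

/-- `τ ∈ Gˢ` preserves the inertia field `Mⁱ = N^{Gⁱ}` (`Gⁱ` is normal in `Gˢ`).
[cite: ZariskiSamuel1960, Ch. VI §12, p. 68] -/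
theorem map_mem_inertiaField_of_mem_decompositionGroupIn {x : Ω}
    (hx : x ∈ (lift (fixedField (inertiaGroupIn V N))).toSubfield)
    {τ : N ≃ₐ[M] N} (hτs : τ ∈ decompositionGroupIn V N) :
    ((τ ⟨x, lift_le _ (show x ∈ lift _ from hx)⟩ : N) : Ω) ∈
      (lift (fixedField (inertiaGroupIn V N))).toSubfield := by
  set xN : N := ⟨x, lift_le _ (show x ∈ lift _ from hx)⟩
  have hxfix : xN ∈ fixedField (inertiaGroupIn V N) := (IntermediateField.mem_lift xN).mp hx
  change ((τ xN : N) : Ω) ∈ lift (fixedField (inertiaGroupIn V N))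
  refine (IntermediateField.mem_lift (τ xN)).mpr ((mem_fixedField_iff _ _).mpr fun σ hσ => ?_)
  have hconj : τ⁻¹ * σ * τ⁻¹⁻¹ ∈ inertiaGroupIn V N :=
    conj_mem_inertiaGroupIn V N ((decompositionGroupIn V N).inv_mem hτs) hσ
  rw [inv_inv] at hconj
  have h1 := (mem_fixedField_iff _ _).mp hxfix _ hconj
  calc σ (τ xN) = τ ((τ⁻¹ * σ * τ) xN) := by
        rw [AlgEquiv.mul_apply, AlgEquiv.mul_apply, ← AlgEquiv.mul_apply τ τ⁻¹, mul_inv_cancel,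
          AlgEquiv.one_apply]
    _ = τ xN := by rw [h1]

end Tools

/-! ## `(LU Mˢ)` gives the stable local uniformization of `Mⁱ` -/

section Tight

variable {S E : Type u} [CommRing S] [Field E] [Algebra S E]

/-- **The converse of the inertia-layer reformulation.** Frame: `S` in an ambient valued field
`(E, O_E)`, `M ∋ S`, `N | M` finite inside `E`, `Gˢ ⊇ Gⁱ` of `O_E ∩ N`, and the henselian
generator `η` of `Mⁱ = Mˢ(η)` (`F` monic over `O_E ∩ Mˢ`, `F(η) = 0`, `v(F′(η)) = 0`). If `Mˢ`
has a local uniformization and local uniformizations of `Mˢ` are cofinal ([CoP1] Cor. 4.6), then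
`Mⁱ` has a local uniformization `S[t]`, `t ⊆ Mⁱ`, whose local ring is `Gˢ`-STABLE and CONTAINS
`η`: take `t = r ∪ {η}` for a local uniformization `S[r]` of `Mˢ` whose local ring contains the
coefficients of `F`; `(S[r, η])_𝔪` is regular (Cor. 6.3), hence normal, so it contains the
conjugates `τη` (`τ ∈ Gˢ`; roots of `F`, fractions of `S[r, η]` as `τη ∈ Mⁱ = Frac S[r, η]`),
and `τ` fixes `S[r] ⊆ Mˢ`. [cite: CossartPiltant2008, proof of Prop. 9.3 (HAL p. 28), "the unique normal local model `S₀ⁱ` of `W ∩ Kⁱ/k` lying above `S₀′`"; CossartPiltant2019, Def. 4.12] -/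
theorem exists_stableInertiaHensel_of_model_decompositionField (OE : ValuationSubring E)
    (M : Subfield E) (hSM : ∀ s : S, algebraMap S E s ∈ M)
    (N : IntermediateField M E) [FiniteDimensional M N]
    {η : E} (hηV : η ∈ OE) (hηI : η ∈ (lift (fixedField (inertiaGroupIn OE N))).toSubfield)
    (F : Polynomial E) (hFmon : F.Monic)
    (hFcoeff : ∀ k, F.coeff k ∈ OE ∧
      F.coeff k ∈ (lift (fixedField (decompositionGroupIn OE N))).toSubfield)
    (hFη : F.eval η = 0) (hF' : OE.valuation ((derivative F).eval η) = 1)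
    (hgen : (lift (fixedField (inertiaGroupIn OE N))).toSubfield =
      (IntermediateField.adjoin (lift (fixedField (decompositionGroupIn OE N))).toSubfield
        ({η} : Set E)).toSubfield)
    (hcof : ∀ (t : Finset E), (t : Set E) ⊆ (lift (fixedField (decompositionGroupIn OE N))).toSubfield →
      (lift (fixedField (decompositionGroupIn OE N))).toSubfield ≤
        Subfield.closure (Set.range (algebraMap S E) ∪ (t : Set E)) →
      ∀ (hTO : (Algebra.adjoin S (t : Set E)).toSubring ≤ OE.toSubring),
      IsRegularLocalRing (Localization.AtPrime
        (Ideal.comap (Subring.inclusion hTO) (maximalIdeal OE))) →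
      ∀ (c : Finset E), (c : Set E) ⊆ (lift (fixedField (decompositionGroupIn OE N))).toSubfield →
        (∀ x ∈ c, x ∈ OE) →
      ∃ t' : Finset E, (t' : Set E) ⊆ (lift (fixedField (decompositionGroupIn OE N))).toSubfield ∧
        (lift (fixedField (decompositionGroupIn OE N))).toSubfield ≤
          Subfield.closure (Set.range (algebraMap S E) ∪ (t' : Set E)) ∧
        ∃ hTO' : (Algebra.adjoin S (t' : Set E)).toSubring ≤ OE.toSubring,
          IsRegularLocalRing (Localization.AtPrime
            (Ideal.comap (Subring.inclusion hTO') (maximalIdeal OE))) ∧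
          ∀ x ∈ c, ∃ a s : E, a ∈ Algebra.adjoin S (t' : Set E) ∧
            s ∈ Algebra.adjoin S (t' : Set E) ∧ OE.valuation s = 1 ∧ x * s = a)
    (hLUs : ∃ t : Finset E, (t : Set E) ⊆ (lift (fixedField (decompositionGroupIn OE N))).toSubfield ∧
      (lift (fixedField (decompositionGroupIn OE N))).toSubfield ≤
        Subfield.closure (Set.range (algebraMap S E) ∪ (t : Set E)) ∧
      ∃ hTO : (Algebra.adjoin S (t : Set E)).toSubring ≤ OE.toSubring,
        IsRegularLocalRing (Localization.AtPrime
          (Ideal.comap (Subring.inclusion hTO) (maximalIdeal OE)))) :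
    ∃ t : Finset E, (t : Set E) ⊆ (lift (fixedField (inertiaGroupIn OE N))).toSubfield ∧
      (lift (fixedField (inertiaGroupIn OE N))).toSubfield ≤
        Subfield.closure (Set.range (algebraMap S E) ∪ (t : Set E)) ∧
      ∃ hTO : (Algebra.adjoin S (t : Set E)).toSubring ≤ OE.toSubring,
        IsRegularLocalRing (Localization.AtPrime
          (Ideal.comap (Subring.inclusion hTO) (maximalIdeal OE))) ∧
        (∀ τ ∈ decompositionGroupIn OE N, ∀ x : N,
          (x : E) ∈ locAtCentre (Algebra.adjoin S (t : Set E)).toSubring OE →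
          ((τ x : N) : E) ∈ locAtCentre (Algebra.adjoin S (t : Set E)).toSubring OE) ∧
        η ∈ locAtCentre (Algebra.adjoin S (t : Set E)).toSubring OE := by
  classical
  have hKsKi : (lift (fixedField (decompositionGroupIn OE N))).toSubfield ≤
      (lift (fixedField (inertiaGroupIn OE N))).toSubfield :=
    lift_fixedField_toSubfield_mono (inertiaGroupIn_le_decompositionGroupIn OE N)
  have hKiN : ∀ x ∈ (lift (fixedField (inertiaGroupIn OE N))).toSubfield, x ∈ N :=
    fun x hx => lift_le _ (show x ∈ lift _ from hx)
  have hSKs : ∀ s : S, algebraMap S E s ∈ (lift (fixedField (decompositionGroupIn OE N))).toSubfield :=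
    fun s => le_lift_toSubfield _ (hSM s)
  obtain ⟨r, hrM, hMcl, hTOr, hregr⟩ := hLUs
  -- cofinality: the coefficients of `F` into the local ring of a finer model of `Mˢ`
  let c : Finset E := (Finset.range (F.natDegree + 1)).image F.coeff
  have hcM : (c : Set E) ⊆ (lift (fixedField (decompositionGroupIn OE N))).toSubfield := by
    intro x hx
    obtain ⟨k, -, rfl⟩ := Finset.mem_image.mp (Finset.mem_coe.mp hx)
    exact (hFcoeff k).2
  have hcO : ∀ x ∈ c, x ∈ OE := by
    intro x hx
    obtain ⟨k, -, rfl⟩ := Finset.mem_image.mp hx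
    exact (hFcoeff k).1
  obtain ⟨r₁, hr₁M, hMcl₁, hTO₁, hreg₁, hrep⟩ := hcof r hrM hMcl hTOr hregr c hcM hcO
  have hcoef : ∀ i, ∃ a s : E, a ∈ Algebra.adjoin S (r₁ : Set E) ∧
      s ∈ Algebra.adjoin S (r₁ : Set E) ∧ OE.valuation s = 1 ∧ F.coeff i * s = a := by
    intro i
    by_cases hi : i ≤ F.natDegree
    · exact hrep (F.coeff i)
        (Finset.mem_image.mpr ⟨i, Finset.mem_range.mpr (Nat.lt_succ_of_le hi), rfl⟩)
    · refine ⟨0, 1, zero_mem _, one_mem _, map_one _, ?_⟩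
      rw [Polynomial.coeff_eq_zero_of_natDegree_lt (not_le.mp hi), zero_mul]
  -- the climb `S[r₁] ↦ S[r₁, η]`
  obtain ⟨hTO', hreg'⟩ := isRegularLocalRing_locAtCentre_insert_of_henselRoot OE r₁ hTO₁ hreg₁ η
    hηV F hFmon hFη hF' hcoef
  haveI : IsRegularLocalRing
      (locAtCentre (Algebra.adjoin S ((insert η r₁ : Finset E) : Set E)).toSubring OE) := hreg'
  haveI : IsDomain (locAtCentre (Algebra.adjoin S ((insert η r₁ : Finset E) : Set E)).toSubring OE) :=
    isDomain_of_isRegularLocalRing _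
  haveI : IsIntegrallyClosed
      (locAtCentre (Algebra.adjoin S ((insert η r₁ : Finset E) : Set E)).toSubring OE) :=
    isIntegrallyClosed_of_isRegularLocalRing _
  have hmono : (Algebra.adjoin S (r₁ : Set E)).toSubring ≤
      (Algebra.adjoin S ((insert η r₁ : Finset E) : Set E)).toSubring := fun z hz =>
    Algebra.adjoin_mono (by rw [Finset.coe_insert]; exact Set.subset_insert _ _) hz
  have htKi : ((insert η r₁ : Finset E) : Set E) ⊆ (lift (fixedField (inertiaGroupIn OE N))).toSubfield := by
    intro z hz
    rw [Finset.coe_insert, Set.mem_insert_iff] at hz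
    rcases hz with rfl | hz
    · exact hηI
    · exact hKsKi (hr₁M hz)
  have hAtKi : ∀ z ∈ Algebra.adjoin S ((insert η r₁ : Finset E) : Set E),
      z ∈ (lift (fixedField (inertiaGroupIn OE N))).toSubfield := by
    intro z hz
    have hle : (Algebra.adjoin S ((insert η r₁ : Finset E) : Set E)).toSubring ≤
        (lift (fixedField (inertiaGroupIn OE N))).toSubfield.toSubring := by
      rw [Algebra.adjoin_eq_ring_closure]
      refine Subring.closure_le.mpr ?_
      rintro w (⟨s, rfl⟩ | hw)
      · exact hKsKi (hSKs s)
      · exact htKi hw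
    exact hle hz
  have hKicl : (lift (fixedField (inertiaGroupIn OE N))).toSubfield ≤
      Subfield.closure (Set.range (algebraMap S E) ∪ ((insert η r₁ : Finset E) : Set E)) := by
    rw [hgen, IntermediateField.adjoin_toSubfield]
    refine Subfield.closure_le.mpr ?_
    rintro z (⟨m, rfl⟩ | hz)
    · exact Subfield.closure_mono (Set.union_subset_union_right _
        (by rw [Finset.coe_insert]; exact Set.subset_insert _ _)) (hMcl₁ m.2)
    · rw [Set.mem_singleton_iff.mp hz]
      exact Subfield.subset_closure (Or.inr (by rw [Finset.coe_insert]; exact Set.mem_insert _ _))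
  refine ⟨insert η r₁, htKi, hKicl, hTO', (isRegularLocalRing_locAtCentre_iff hTO').mp hreg', ?_,
    le_locAtCentre _ OE (Algebra.subset_adjoin (by rw [Finset.coe_insert]; exact Set.mem_insert _ _))⟩
  -- stability of the local ring `T = (S[r₁, η])_𝔪` under `Gˢ`
  intro τ hτ x hx
  have hfixKs : ∀ z ∈ (lift (fixedField (decompositionGroupIn OE N))).toSubfield, ∀ hz : z ∈ N,
      τ ⟨z, hz⟩ = ⟨z, hz⟩ := fun z hzs hz =>
    (mem_fixedField_iff _ _).mp ((IntermediateField.mem_lift (⟨z, hz⟩ : N)).mp hzs) τ hτ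
  have hηN : η ∈ N := hKiN η hηI
  -- `τη ∈ T` by normality
  have hτη : ((τ ⟨η, hηN⟩ : N) : E) ∈
      locAtCentre (Algebra.adjoin S ((insert η r₁ : Finset E) : Set E)).toSubring OE := by
    have hcoT : ∀ k, F.coeff k ∈
        locAtCentre (Algebra.adjoin S ((insert η r₁ : Finset E) : Set E)).toSubring OE := by
      intro k
      obtain ⟨a, s, ha, hs, hvs, hk⟩ := hcoef k
      have hs0 : s ≠ 0 := ne_zero_of_valuation_eq_one hvs
      have : F.coeff k = a / s := by rw [← hk, mul_div_cancel_right₀ _ hs0]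
      rw [this]
      exact locAtCentre_mono OE hmono ⟨a, ha, s, hs, hvs, rfl⟩
    have hint : IsIntegral (locAtCentre (Algebra.adjoin S ((insert η r₁ : Finset E) : Set E)).toSubring OE)
        ((τ ⟨η, hηN⟩ : N) : E) := by
      have hl : F ∈ Polynomial.lifts (algebraMap
          (locAtCentre (Algebra.adjoin S ((insert η r₁ : Finset E) : Set E)).toSubring OE) E) := by
        rw [Polynomial.lifts_iff_coeff_lifts]
        intro k
        exact ⟨⟨F.coeff k, hcoT k⟩, rfl⟩
      obtain ⟨P, hP, -, hPmon⟩ := Polynomial.lifts_and_degree_eq_and_monic hl hFmon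
      refine ⟨P, hPmon, ?_⟩
      rw [← Polynomial.eval_map, hP]
      exact eval_map_decompositionGroup_henselRoot OE N hηN F (fun k => (hFcoeff k).2) hFη hτ
    have hτηKi := map_mem_inertiaField_of_mem_decompositionGroupIn OE N hηI hτ
    have hfrac := hKicl hτηKi
    obtain ⟨y, hy, z, hz, hyz⟩ := Subfield.mem_closure_iff.mp hfrac
    rw [← Algebra.adjoin_eq_ring_closure] at hy hz
    by_cases hz0 : z = 0
    · have : ((τ ⟨η, hηN⟩ : N) : E) = 0 := by rw [← hyz, hz0, div_zero]
      rw [this]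
      exact Subring.zero_mem _
    · refine mem_of_isIntegral_of_mul_mem_subring _ hint (le_locAtCentre _ OE hz) hz0 ?_
      rw [← hyz, mul_div_cancel₀ _ hz0]
      exact le_locAtCentre _ OE hy
  -- every generator, hence all of `S[r₁, η]`, is mapped into `T`
  let R₀ : Subring E :=
    { carrier := {w | ∃ hw : w ∈ N, ((τ ⟨w, hw⟩ : N) : E) ∈
        locAtCentre (Algebra.adjoin S ((insert η r₁ : Finset E) : Set E)).toSubring OE}
      mul_mem' := by
        rintro a b ⟨ha, hτa⟩ ⟨hb, hτb⟩
        refine ⟨N.mul_mem ha hb, ?_⟩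
        have : (⟨a * b, N.mul_mem ha hb⟩ : N) = ⟨a, ha⟩ * ⟨b, hb⟩ := rfl
        rw [this, map_mul, MulMemClass.coe_mul]
        exact Subring.mul_mem _ hτa hτb
      one_mem' := ⟨N.one_mem, by
        have : (⟨1, N.one_mem⟩ : N) = 1 := rfl
        rw [this, map_one, OneMemClass.coe_one]
        exact Subring.one_mem _⟩
      add_mem' := by
        rintro a b ⟨ha, hτa⟩ ⟨hb, hτb⟩
        refine ⟨N.add_mem ha hb, ?_⟩
        have : (⟨a + b, N.add_mem ha hb⟩ : N) = ⟨a, ha⟩ + ⟨b, hb⟩ := rfl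
        rw [this, map_add, AddMemClass.coe_add]
        exact Subring.add_mem _ hτa hτb
      zero_mem' := ⟨N.zero_mem, by
        have : (⟨0, N.zero_mem⟩ : N) = 0 := rfl
        rw [this, map_zero, ZeroMemClass.coe_zero]
        exact Subring.zero_mem _⟩
      neg_mem' := by
        rintro a ⟨ha, hτa⟩
        refine ⟨N.neg_mem ha, ?_⟩
        have : (⟨-a, N.neg_mem ha⟩ : N) = -⟨a, ha⟩ := rfl
        rw [this, map_neg, NegMemClass.coe_neg]
        exact Subring.neg_mem _ hτa }
  have hgenT : (Algebra.adjoin S ((insert η r₁ : Finset E) : Set E)).toSubring ≤ R₀ := by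
    rw [Algebra.adjoin_eq_ring_closure]
    refine Subring.closure_le.mpr ?_
    rintro w (⟨s, rfl⟩ | hw)
    · refine ⟨hKiN _ (hKsKi (hSKs s)), ?_⟩
      rw [hfixKs _ (hSKs s)]
      exact le_locAtCentre _ OE (Subalgebra.algebraMap_mem _ s)
    · have hwt : w ∈ Algebra.adjoin S ((insert η r₁ : Finset E) : Set E) := Algebra.subset_adjoin hw
      rw [Finset.coe_insert, Set.mem_insert_iff] at hw
      rcases hw with rfl | hw
      · exact ⟨hηN, hτη⟩
      · refine ⟨hKiN _ (hKsKi (hr₁M hw)), ?_⟩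
        rw [hfixKs _ (hr₁M hw)]
        exact le_locAtCentre _ OE hwt
  -- fractions
  obtain ⟨y, hy, z, hz, hvz, hxyz⟩ := mem_locAtCentre_iff.mp hx
  obtain ⟨hyN, hτy⟩ := hgenT hy
  obtain ⟨hzN, hτz⟩ := hgenT hz
  have hz0 : z ≠ 0 := ne_zero_of_valuation_eq_one hvz
  have hxeq : x = ⟨y, hyN⟩ / ⟨z, hzN⟩ := by
    apply Subtype.ext
    rw [hxyz]
    rfl
  have hvτz : OE.valuation ((τ ⟨z, hzN⟩ : N) : E) = 1 :=
    valuation_map_eq_one_of_mem_decompositionGroupIn OE N hτ (x := ⟨z, hzN⟩) hvz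
  have hu : IsUnit (⟨((τ ⟨z, hzN⟩ : N) : E), hτz⟩ :
      locAtCentre (Algebra.adjoin S ((insert η r₁ : Finset E) : Set E)).toSubring OE) :=
    isUnit_locAtCentre_of_valuation_eq_one OE hTO' _ hvτz
  obtain ⟨w, hw⟩ := hu.exists_right_inv
  have hwE : ((τ ⟨z, hzN⟩ : N) : E) * (w : E) = 1 := by
    have := congrArg (fun q : locAtCentre (Algebra.adjoin S ((insert η r₁ : Finset E) : Set E)).toSubring OE
      => (q : E)) hw
    simpa using this
  have hτz0 : ((τ ⟨z, hzN⟩ : N) : E) ≠ 0 := ne_zero_of_valuation_eq_one hvτz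
  have hwinv : (w : E) = (((τ ⟨z, hzN⟩ : N) : E))⁻¹ := (eq_inv_of_mul_eq_one_right hwE)
  rw [hxeq, map_div₀]
  have hcoe : (((τ ⟨y, hyN⟩ / τ ⟨z, hzN⟩ : N)) : E) =
      ((τ ⟨y, hyN⟩ : N) : E) / ((τ ⟨z, hzN⟩ : N) : E) := rfl
  rw [hcoe, div_eq_mul_inv, ← hwinv]
  exact Subring.mul_mem _ hτy w.2

end Tight

end Literature.AlgebraicGeometry.Resolution

end
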